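import Summits.NavierStokesRegularity.NavierStokesRegularity.Theorems.SoloRefuteTibola2025Witness
import Literature.Claims.NS.Tibola2025
import HarnessLib

/-!
# Solo refutation — C173 `Tibola2025` (Ben Tibola, «Global Regularity for 3D Navier–Stokes via Finite-Scale
# Contraction and Audited Pressure Ledgers», Zenodo record 17625718, single version 2025-11-17, 59 pp.; PDF sha16
# 1b36a833af6a98c4), PART B: the kill

D-0090 «where NS proofs break» map, cell `ns-claims`; refuter of record ns-claims-refuter-6 g5 (blind prediction
PREDICTED-R sealed fdbb709d2114b24f 16:36:31Z, before TYPED / CARD §5 / the second's seal; its P1 = this token and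
class). Skeleton of record `Literature.Claims.NS.Tibola2025` (typist-9 g6, p550041 ACCEPTED @ 8fbdb4dbdfc5, tree
sha16 8797a98e93e9a6b7, 581 l.), imported BY IMPORT; witness family = PART A
`Summits.….Theorems.SoloRefuteTibola2025Witness` (by import). Text of record = census pin `census/texts/Tibola2025/`.

**Token = binder 3 of `claim_of_steps` (skeleton l.488), the SEAM `Step_L1220_of K L ν` (l.354) :=
`Step_T1219 K L → Step_C1221 L → Step_L1220 K L ν`, killed at its consequent `Step_L1220 K L ν` (l.332)** =
Lemma 12.20 display (12.12) p.32 l.55–66 «Let Λ = 6 and suppose θ(6) < 1. For Φ(ρ) := ‖u‖³_{L³(B_ρ)} +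
‖p‖^{3/2}_{L^{3/2}(B_ρ)} (normalized as in §§9–11), Φ(r) ≤ θ(6) Φ(6r)», typed (REF-2 RETYPE (a), the §10.2 p.20
l.80–90 normalisation) as `Phi u π r z = (r²)⁻¹ ∬_{Q_r(z)} (|u|³ + |π|^{3/2})` over the parabolic cylinder
`cyl r z = (t₀ − r², t₀) × B_r(x₀)`, for every datum/force of the printed classes (`IsDatum`, `IsForce`), every
global Leray–Hopf solution (`Torus.IsGlobalLerayHopf`), every `r > 0` with `Admissible (6r) z`, the pressure being
the kit's `K.press u₀ f u` (pinned on classical mean-zero pairs by `URKit.press_classical`), `θ(6) = L.theta 6`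
ledger-level. Binders 1–2 (`Step_T1219` = (12.10) WITH its additive term, TRUE-type, kit-relative; `Step_C1221` =
`θ(6) < 1`, true on the printed digits `table4_theta6_lt_one`) carry no kernel object and are taken as hypotheses
of `not_Step_L1220_of`.
**Class: FALSE LEMMA (countermodel)** — `not_Step_L1220 (K) (L) (hθ : L.theta 6 < 36) (ν) : ¬ Step_L1220 K L ν`
(EVERY kit, EVERY ledger with θ(6) < 36 ⊋ Cor 12.21's θ(6) < 1, EVERY ν — the viscosity plays no role), whence
`not_Step_L1220_of (K) (L) (ν) (h1219 : Step_T1219 K L) (h1221 : Step_C1221 L) : ¬ Step_L1220_of K L ν` and,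
outright, `not_Step_L1220_of_zeroGadgets` (the seam is false for the zero-gadget kit of any kit at every ledger
with θ(6) < 1). Witness (PART A): `u(t, x) = S(t − s)·V_δ(x)`, `p ≡ 0`, `f := ∂ₜu + (u·∇)u − νΔu`, with
`δ = 1/24`, `t₀ = 1`, `r = 1/12` (`6r = 1/2`, `(6r)² = 1/4 < t₀`: `Admissible`), `s = t₀ − r² = 143/144`,
`x₀ = proj(½, ½, ½)`; datum `u(0) = 0` and every slice in `IsDatum` (`isDatum_vel`), `f ∈ IsForce`
(`isForce_force`: continuous on compact slabs), `u` global Leray–Hopf (`isGlobalLerayHopf_witness`), kit pressure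
`= 0` (`press_witness`). The integrand `|u|³ + |π|^{3/2}` vanishes on `Q_{6r} ∖ Q_r` (`t ≤ s`, or torus distance
`> δ` from `x₀`), so both cylinders carry the same mass `M ∈ (0, ∞)`: `Φ(r) = 144·M`, `Φ(6r) = 4·M`, and (12.12)
reads `144·M ≤ θ(6)·4·M`, i.e. `θ(6) ≥ 36` — contradiction. (DEGENERATE-WITNESS rule: the witness is a
non-stationary, nonconstant, genuinely forced classical solution; its datum `0` and force lie in the printed
classes «u₀ ∈ L², divergence-free … f ∈ L¹_loc H⁻¹ with local L^{3/2} control», Thm .1 p.39 l.10–26; no clause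
of the print excludes it.)
HONEST SCOPE: (i) the literal ball face `Step_L1220_ball` (l.342, not consumed) is violated by the same slice too
(for `δ < ρ`, `6ρ ≤ 1/2`, `t ∈ (s, t₀]` the balls `B_ρ ⊂ B_{6ρ}` carry EQUAL positive mass, ratio `1 > θ(6)`) — a
corollary NOT typed in this kit (line cap) and not keyed; (ii) an UNFORCED typing (f ≡ 0) is not bitten by this
family (the backward-parabolic mass of an unforced smooth solution does not jump by a factor 36 into the top
sub-cylinder) — the print's class is forced; (iii) `URKit` is quantified, not inhabited, here: the kill holds for
every kit (on paper the mean-zero Poisson pressure inhabits it).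

WHAT THIS IS NOT: not a claim about NS regularity or blow-up; not a claim about any author beyond the typed
locator. [cite: Tibola2025] [cite: CaffarelliKohnNirenberg1982, §2 (the scale-invariant quantities)]
-/

set_option linter.dupNamespace false

noncomputable section

open Set Function Metric MeasureTheory
open scoped ContDiff ENNReal

namespace Summit.NavierStokesRegularity.NavierStokesRegularity.Theorems.Tibola2025

open Literature.Analysis.FunctionSpaces Literature.Analysis.FunctionSpaces.Torus
open Literature.Claims.NS.Tibola2025 (IsDatum IsForce URKit Ledger Phi Admissible Step_T1219 Step_C1221
  Step_L1220 Step_L1220_of table4_kappaw6 table4_Ciso table4_ctail table4_C0 table4_cloc table4_theta6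
  table4_theta6_lt_one Ledger.theta Ledger.cloc)

variable {δ : ℝ}

/-! ## The witness is in the printed classes -/

/-- Every time slice of the witness is in the printed data class: `L²(𝕋³)` (continuous on a compact space) and
weakly divergence-free (smooth and divergence-free, `Torus.IsDivFree.isWeaklyDivFree_holds`). [folklore] -/
theorem isDatum_vel (ν : ℝ) (hδ : 0 < δ) (hδ' : δ < 1 / 2) (s t : ℝ) : IsDatum (vel δ s t) := by
  have hs : IsSmooth (vel δ s t) := (isSmooth_V hδ).smul (sw s t)
  have hd : IsDivFree (vel δ s t) := fun x =>
    (isClassicalNSSolutionOn_vel ν hδ hδ' s).divFree t (mem_univ t) x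
  have hc : Continuous (vel δ s t) := hs.continuous
  obtain ⟨B, hB⟩ := isCompact_univ.exists_bound_of_continuousOn hc.continuousOn
  exact ⟨MemLp.of_bound hc.aestronglyMeasurable B (ae_of_all _ fun y => hB y (mem_univ y)),
    IsDivFree.isWeaklyDivFree_holds hs hd⟩

/-- The witness force is in the printed force class `IsForce` (a.e.-strongly measurable — it is continuous — and
`∬_{(0,T)×𝕋³} |f|^{3/2} < ∞` for every `T > 0`: a continuous function on the compact `[0,T] × 𝕋³` is bounded).
[folklore] -/
theorem isForce_force (ν : ℝ) (hδ : 0 < δ) (s : ℝ) : IsForce (force ν δ s) := by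
  have hc := continuous_force_uncurry ν hδ s
  refine ⟨hc.aestronglyMeasurable, fun T hT => ?_⟩
  have hK : IsCompact (Icc 0 T ×ˢ (univ : Set T3)) := isCompact_Icc.prod isCompact_univ
  have hcG : Continuous fun q : ℝ × T3 => ‖force ν δ s q.1 q.2‖ₑ ^ (3 / 2 : ℝ) :=
    ENNReal.continuous_rpow_const.comp hc.enorm
  obtain ⟨q₀, _, hq₀⟩ := hK.exists_isMaxOn ⟨((0 : ℝ), (proj qc : T3)), ⟨⟨le_rfl, hT.le⟩, mem_univ _⟩⟩
    hcG.continuousOn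
  have hsub : Ioo 0 T ×ˢ (univ : Set T3) ⊆ Icc 0 T ×ˢ univ := prod_mono Ioo_subset_Icc_self subset_rfl
  calc ∫⁻ q in Ioo 0 T ×ˢ (univ : Set T3), ‖force ν δ s q.1 q.2‖ₑ ^ (3 / 2 : ℝ)
      ≤ ∫⁻ _ in Ioo 0 T ×ˢ (univ : Set T3), ‖force ν δ s q₀.1 q₀.2‖ₑ ^ (3 / 2 : ℝ) :=
        setLIntegral_mono' (measurableSet_Ioo.prod MeasurableSet.univ) fun q hq => hq₀ (hsub hq)
    _ = ‖force ν δ s q₀.1 q₀.2‖ₑ ^ (3 / 2 : ℝ) * volume (Ioo 0 T ×ˢ (univ : Set T3)) :=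
        setLIntegral_const _ _
    _ < ⊤ := by
        refine ENNReal.mul_lt_top (ENNReal.rpow_lt_top_of_nonneg (by norm_num) enorm_ne_top) ?_
        rw [Measure.volume_eq_prod, Measure.prod_prod]
        exact ENNReal.mul_lt_top measure_Ioo_lt_top (measure_lt_top _ _)

/-- The witness is a global Leray–Hopf solution from its own time-zero slice, in the skeleton's spelling. [folklore] -/
theorem isGlobalLerayHopf_witness (ν : ℝ) (hδ : 0 < δ) (hδ' : δ < 1 / 2) (s : ℝ) :
    Literature.Analysis.FluidPDE.Torus.IsGlobalLerayHopf ν (force ν δ s) (vel δ s 0) (vel δ s) :=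
  isGlobalLerayHopf_vel ν hδ hδ' s

/-- **The kit's pressure is pinned on the witness**: `π = 0` (the witness is a classical pair on the time set
`univ` with the zero — hence mean-zero — pressure; `URKit.press_classical`). -/
theorem press_witness (K : URKit) (ν : ℝ) (hδ : 0 < δ) (hδ' : δ < 1 / 2) (s : ℝ) :
    K.press (vel δ s 0) (force ν δ s) (vel δ s) = pres := by
  funext t
  exact K.press_classical ν univ (vel δ s 0) (force ν δ s) (vel δ s) pres
    (isClassicalNSSolutionOn_vel ν hδ hδ' s) (fun t _ => by simp [pres]) t (mem_univ t)

/-! ## The kill -/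

/-- **KILL (content of binder 3 of `claim_of_steps`) — Lemma 12.20 display (12.12) p.32 l.55–66 is FALSE for
EVERY kit `K : URKit`, EVERY ledger with `θ(6) < 36` (a fortiori under Cor 12.21's `θ(6) < 1` = `Step_C1221`,
binder 2) and EVERY viscosity `ν`.** Witness: the PART A bump with `δ = 1/24`, switched on at `s = t₀ − r²`,
`t₀ = 1`, `r = 1/12`, centre `x₀ = proj q`; datum `u(0) = 0` (`s > 0`; the printed class is ALL `L²`
divergence-free data, Thm .1 p.39 l.12–16), force in `IsForce`, `u` global Leray–Hopf, `π = 0` by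
`press_witness`; the cylinder `Q_{6r}(x₀, t₀) = (3/4, 1) × B_{1/2}` is `Admissible` (`6r = 1/2`, `(6r)² < t₀`).
Since `|u|³ + |π|^{3/2}` vanishes on `Q_{6r} ∖ Q_r` (`t ≤ s` or torus distance `> δ`), both cylinders carry the
same mass `M ∈ (0, ∞)`, so `Φ(r) = 144·M` and `Φ(6r) = 4·M`: (12.12) reads `144 M ≤ θ(6)·4 M`, i.e.
`θ(6) ≥ 36`. [cite: Tibola2025, Lemma 12.20 (12.12) p.32 l.55–66; §10.2 p.20 l.80–90 (normalisation r⁻²)] -/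
theorem not_Step_L1220 (K : URKit) (L : Ledger) (hθ : L.theta 6 < 36) (ν : ℝ) : ¬ Step_L1220 K L ν := by
  intro h
  obtain ⟨δ, hδdef⟩ : ∃ δ : ℝ, δ = 1 / 24 := ⟨_, rfl⟩
  obtain ⟨r, hr⟩ : ∃ r : ℝ, r = 1 / 12 := ⟨_, rfl⟩
  obtain ⟨t₀, ht₀⟩ : ∃ t₀ : ℝ, t₀ = 1 := ⟨_, rfl⟩
  have hδ : 0 < δ := by rw [hδdef]; norm_num
  have hδ' : δ < 1 / 2 := by rw [hδdef]; norm_num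
  have hδr : δ < r := by rw [hδdef, hr]; norm_num
  obtain ⟨s, hs⟩ : ∃ s : ℝ, s = t₀ - r ^ 2 := ⟨_, rfl⟩
  have key := h (vel δ s 0) (force ν δ s) (vel δ s) (isDatum_vel ν hδ hδ' s 0) (isForce_force ν hδ s)
    (isGlobalLerayHopf_witness ν hδ hδ' s) r (t₀, proj qc) (by rw [hr]; norm_num)
    ⟨by rw [hr]; norm_num, by rw [hr]; norm_num, by show (6 * r) ^ 2 < t₀; rw [hr, ht₀]; norm_num⟩
  rw [press_witness K ν hδ hδ' s] at key
  -- the integrand as `G ∘ u`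
  set G : E3 → ℝ≥0∞ := fun v => ‖v‖ₑ ^ (3 : ℕ) + ‖(0 : ℝ)‖ₑ ^ (3 / 2 : ℝ) with hG
  have h32 : (0 : ℝ) < 3 / 2 := by norm_num
  have hG0 : G 0 = 0 := by simp [hG, ENNReal.zero_rpow_of_pos h32]
  have hGm : Measurable G := by
    simp only [hG, enorm_zero, ENNReal.zero_rpow_of_pos h32, add_zero]
    exact measurable_enorm.pow_const _
  have hGp : ∀ v, v ≠ 0 → G v ≠ 0 := by
    intro v hv
    simp only [hG, enorm_zero, ENNReal.zero_rpow_of_pos h32, add_zero]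
    exact pow_ne_zero _ (by simpa using hv)
  have hGc : Continuous G := by
    simp only [hG, enorm_zero, ENNReal.zero_rpow_of_pos h32, add_zero]
    exact (ENNReal.continuous_pow 3).comp continuous_enorm
  have hGf : ∀ v, G v ≠ ⊤ := by
    intro v
    simp only [hG, enorm_zero, ENNReal.zero_rpow_of_pos h32, add_zero]
    exact ENNReal.pow_ne_top enorm_ne_top
  have hΦ : ∀ ρ : ℝ, Phi (vel δ s) pres ρ (t₀, proj qc)
      = (ENNReal.ofReal (ρ ^ 2))⁻¹ * ∫⁻ q in cylST (t₀ - ρ ^ 2) t₀ (proj qc) ρ, G (vel δ s q.1 q.2) :=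
    fun ρ => rfl
  rw [hΦ, hΦ] at key
  have heq := setLIntegral_cyl_eq hδ hδ' (t₀ := t₀) (le_of_eq hs.symm)
    (show t₀ - (6 * r) ^ 2 ≤ s by rw [hs, hr, ht₀]; norm_num) hδr (by rw [hδdef, hr]; norm_num : δ < 6 * r) G hG0
  have hpos := setLIntegral_cyl_pos hδ hδ' (t₀ := t₀) (le_of_eq hs.symm)
    (show s < t₀ by rw [hs, hr, ht₀]; norm_num) hδr G hGm hGp
  have hfin := setLIntegral_cyl_lt_top hδ (t₀ := t₀) (a := t₀ - r ^ 2) (R := r) (s := s) G hGc hGf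
  rw [← heq] at key
  set M := ∫⁻ q in cylST (t₀ - r ^ 2) t₀ (proj qc) r, G (vel δ s q.1 q.2) with hM
  have hM0 : M ≠ 0 := hpos.ne'
  have hMt : M ≠ ⊤ := hfin.ne
  have h1 : (ENNReal.ofReal (r ^ 2))⁻¹ = ENNReal.ofReal 144 := by
    rw [hr, ← ENNReal.ofReal_inv_of_pos (by norm_num)]; norm_num
  have h2 : (ENNReal.ofReal ((6 * r) ^ 2))⁻¹ = ENNReal.ofReal 4 := by
    rw [hr, ← ENNReal.ofReal_inv_of_pos (by norm_num)]; norm_num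
  rw [h1, h2, ← mul_assoc, ← ENNReal.ofReal_mul' (by norm_num : (0 : ℝ) ≤ 4)] at key
  have key' := (ENNReal.mul_le_mul_iff_left hM0 hMt).1 key
  rcases ENNReal.ofReal_le_ofReal_iff'.1 key' with h' | h' <;> linarith

/-- **KILL of binder 3 of `claim_of_steps` — the SEAM `Step_L1220_of K L ν` (Lemma 12.20 p.32 l.57–66 «Let
Λ = 6 and suppose θ(6) < 1 …») is FALSE as soon as binders 1 and 2 (`Step_T1219 K L`, `Step_C1221 L`) are in
hand**: its consequent is refuted by `not_Step_L1220` for every kit and every ledger with `θ(6) < 36`.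
[cite: Tibola2025, Lemma 12.20 p.32 l.55–66; Thm 12.19 (12.10) p.32 l.18–38; Cor 12.21 p.32 l.67–73] -/
theorem not_Step_L1220_of (K : URKit) (L : Ledger) (ν : ℝ) (h1219 : Step_T1219 K L)
    (h1221 : Step_C1221 L) : ¬ Step_L1220_of K L ν := fun hseam =>
  not_Step_L1220 K L (lt_trans h1221 (by norm_num)) ν (hseam h1219 h1221)

/-- Under Cor 12.21's certificate alone (`Step_C1221 L`, binder 2), Lemma 12.20's content is false for every
kit and every viscosity. [cite: Tibola2025, Cor 12.21 p.32 l.67–73; Lemma 12.20 (12.12) p.32 l.55–66] -/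
theorem not_Step_L1220_of_C1221 (K : URKit) (L : Ledger) (h1221 : Step_C1221 L) (ν : ℝ) :
    ¬ Step_L1220 K L ν :=
  not_Step_L1220 K L (lt_trans h1221 (by norm_num)) ν

/-- The kit with the same pressure and ZERO discrete gadgets `A_h = E_h = F_h = 0` (data; for it (12.10)
`Step_T1219` holds trivially) — used only to record that the seam is refutable outright at the printed
certificate. -/
def zeroGadgets (K : URKit) : URKit := ⟨0, 0, 0, K.press, K.press_classical⟩

/-- (12.10) holds for the zero gadgets (`0 ≤ …`). [folklore] -/
theorem step_T1219_zeroGadgets (K : URKit) (L : Ledger) : Step_T1219 (zeroGadgets K) L :=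
  fun _ _ _ _ => ⟨0, fun _ _ _ _ _ _ _ _ _ _ => by simp [zeroGadgets]⟩

/-- **The seam refuted outright** for the zero-gadget kit of any kit, at every ledger satisfying Cor 12.21
(`θ(6) < 1`, e.g. the Table-4 value `table4_theta6_lt_one`) and every `ν`. [cite: Tibola2025, Lemma 12.20 p.32 l.55–66] -/
theorem not_Step_L1220_of_zeroGadgets (K : URKit) (L : Ledger) (h1221 : Step_C1221 L) (ν : ℝ) :
    ¬ Step_L1220_of (zeroGadgets K) L ν :=
  not_Step_L1220_of (zeroGadgets K) L ν (step_T1219_zeroGadgets K L) h1221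

/-! ## The record at the printed certificate (REF-2 flag R1: `0 < θ(6) < 1`, Table 4 / p.48) -/

/-- A ledger carrying the PRINTED Table-4 / p.48 values `C0 = C1 = 6.545455`, `C_iso = 8`, `c_tail = 5.83e-15`,
`κ_w ≡ 4.36e-12` (App. I′ p.47 l.42–54, p.48 l.1–13), with the UNPRINTED near-field prefactor chosen as
`C_NF := c_loc/(C0 + C1)` and `C∗ = M1 = M2 = 0`, so that (12.11) returns the printed `c_loc = 4.158` and
`θ(6) = table4_theta6 = 0.6930000000044 ∈ (0, 1)`. [cite: Tibola2025, App. I′ Table 4 p.47 l.42–54; p.48 l.1–13] -/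
def ledgerTable4 : Ledger :=
  ⟨fun _ => table4_kappaw6, table4_Ciso, table4_ctail, table4_C0, table4_C0, 0,
    table4_cloc / (table4_C0 + table4_C0), 0, 0⟩

/-- (12.11) on `ledgerTable4` gives the printed `θ(6)`. [cite: Tibola2025, p.48 l.12–13] -/
theorem theta6_ledgerTable4 : ledgerTable4.theta 6 = table4_theta6 := by
  have hC : table4_C0 + table4_C0 ≠ 0 := by norm_num [table4_C0]
  simp only [Ledger.theta, Ledger.cloc, ledgerTable4, table4_theta6, zero_mul, add_zero]
  rw [div_mul_cancel₀ _ hC]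

/-- The printed certificate holds on `ledgerTable4` with `θ(6) ∈ (0, 1)` (Cor 12.21 instantiated by App. I′;
the typist's `table4_theta6_lt_one`). [cite: Tibola2025, Cor 12.21 p.32 l.67–73; p.48 l.12–17] -/
theorem step_C1221_ledgerTable4 : Step_C1221 ledgerTable4 ∧ 0 < ledgerTable4.theta 6 := by
  refine ⟨?_, ?_⟩
  · show ledgerTable4.theta 6 < 1
    rw [theta6_ledgerTable4]; exact table4_theta6_lt_one
  · rw [theta6_ledgerTable4]; norm_num [table4_theta6, table4_kappaw6, table4_cloc]

/-- **Lemma 12.20 is false AT THE PRINTED CERTIFICATE `θ(6) = 0.693…`**, for every kit and every viscosity.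
[cite: Tibola2025, Lemma 12.20 (12.12) p.32 l.55–66; p.48 l.12–13] -/
theorem not_Step_L1220_table4 (K : URKit) (ν : ℝ) : ¬ Step_L1220 K ledgerTable4 ν :=
  not_Step_L1220_of_C1221 K ledgerTable4 step_C1221_ledgerTable4.1 ν

/-- **The seam is false OUTRIGHT at the printed certificate** for the zero-gadget kit of any kit (binders 1–2
then hold: `step_T1219_zeroGadgets`, `step_C1221_ledgerTable4`), every `ν`. [cite: Tibola2025, Lemma 12.20 p.32 l.55–66] -/
theorem not_Step_L1220_of_table4 (K : URKit) (ν : ℝ) : ¬ Step_L1220_of (zeroGadgets K) ledgerTable4 ν :=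
  not_Step_L1220_of_zeroGadgets K ledgerTable4 step_C1221_ledgerTable4.1 ν

end Summit.NavierStokesRegularity.NavierStokesRegularity.Theorems.Tibola2025

end
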